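import Summits.ValiantsHypothesis.ValiantsHypothesis.Theorems.SymPencilPerFourToricOneLow
import Summits.ValiantsHypothesis.ValiantsHypothesis.Theorems.SymPencilPerFourToricDistinct

/-!
# Route `SymPencil` — the toric case at dimension `6`, IX: H3 with all row and column ranks `≤ 2`
# forces `dim W ≤ 5` (`--supports` stmt-ValiantsHypothesis-5674 `SdcSuperquadratic`; crux
# workfile `Cruxes/SdcSuperquadratic/TORIC-SIX.md`)

**Theorem** (`finrank_le_five_of_ranks_le_two`).  Over a field of characteristic `0`, a linear
space `W` of `4 × 4` matrices on which all `3 × 3` subpermanents vanish and all of whose rows and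
columns have rank `≤ 2` has `dim W ≤ 5`.  (val-width-5674-p2's
`SymPencilPerFourHessianToric.finrank_le_six_of_ranks_le_two` gave `≤ 6`; the bound `6` is not
attained.)  Assembly of the profile analysis: a row of rank `≤ 1`
(`SymPencilPerFourToricOneLow`, with `…ToricZeroRow`, `…ToricLowRank`), else all rows of rank `2`
and either two rows with the same image (`SymPencilPerFourToricEqualRows`) or four distinct images
(`SymPencilPerFourToricDistinct`).  No Hessian / swapped-family input is used.

Use: the toric case of the `6`-dimensional residual `R6` of the `(10, 6, 4)` cell.  Honest
framing: nothing here changes `sdc(per_4) ≥ 25`; the crux `SdcSuperquadratic` and `VP ≠ VNP` are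
untouched.  No definitions, no named facts. [folklore]
-/

noncomputable section

-- single-conjunct layout: Sub = Summit, duplicated namespace component intended
set_option linter.dupNamespace false

namespace Summit.ValiantsHypothesis.ValiantsHypothesis.Theorems.SymPencilPerFourToricFive

open Matrix Finset Module
open Summit.ValiantsHypothesis.ValiantsHypothesis.Theorems.SymPencilPerFourHessianToric
open Summit.ValiantsHypothesis.ValiantsHypothesis.Theorems.SymPencilPerFourToricOneLow
open Summit.ValiantsHypothesis.ValiantsHypothesis.Theorems.SymPencilPerFourToricEqualRows
open Summit.ValiantsHypothesis.ValiantsHypothesis.Theorems.SymPencilPerFourToricDistinct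

variable {K : Type*} [Field K]

/-- **The toric bound: `dim W ≤ 5`.**  See the module docstring. [folklore] -/
theorem finrank_le_five_of_ranks_le_two [CharZero K] (W : Submodule K (Fin 4 × Fin 4 → K))
    (hW3 : ∀ x ∈ W, ∀ (r c : Fin 3 → Fin 4), Function.Injective r → Function.Injective c →
      ((Matrix.of fun i j => x (i, j)).submatrix r c).permanent = 0)
    (hrow : ∀ r : Fin 4, finrank K (W.map (LinearMap.funLeft K K fun l : Fin 4 => (r, l))) ≤ 2)
    (hcol : ∀ l : Fin 4, finrank K (W.map (LinearMap.funLeft K K fun i : Fin 4 => (i, l))) ≤ 2) :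
    finrank K W ≤ 5 := by
  classical
  have h6' := finrank_le_six_of_ranks_le_two W hW3 hrow hcol
  by_contra hgt
  have h6 : finrank K W = 6 := by omega
  by_cases hlow : ∃ q, finrank K (W.map (LinearMap.funLeft K K fun l : Fin 4 => (q, l))) ≤ 1
  · obtain ⟨q, hq⟩ := hlow
    exact false_of_row_rank_le_one W hW3 hrow hcol h6 q hq
  push Not at hlow
  have hn2 : ∀ r : Fin 4, finrank K (W.map (LinearMap.funLeft K K fun l : Fin 4 => (r, l))) = 2 :=
    fun r => by have := hlow r; have := hrow r; omega
  by_cases heq : ∃ r r' : Fin 4, r ≠ r' ∧ W.map (LinearMap.funLeft K K fun l : Fin 4 => (r, l)) =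
      W.map (LinearMap.funLeft K K fun l : Fin 4 => (r', l))
  · obtain ⟨r, r', hrr', hL⟩ := heq
    exact false_of_rows_eq W hW3 hcol h6 hn2 r r' hrr' hL
  · push Not at heq
    exact false_of_rows_distinct W hW3 hcol h6 hn2 heq

end Summit.ValiantsHypothesis.ValiantsHypothesis.Theorems.SymPencilPerFourToricFive

end
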